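import Literature.NumberTheory.PAdicHodge.WeilPairingPeriodExtension
import HarnessLib

/-!
# The cochain `g(σ) = −⟨η σ, σ ỹ⟩~` presenting `η ∪ κ` is `Fil¹`-valued, and lifts to `Fil¹ B_dR⁺(F)`

Topic `Literature/NumberTheory/PAdicHodge`. Sequel of `WeilPairingPeriodExtension` (the extended Weil pairing
`⟨·,·⟩~ : T_pW × (B ⊗ V_pW) → B` along the period line and Kato's formal argument
`isCoboundaryLift_weilContPairingPadic_right`: the cup-product cocycle `η ∪_{e_∞} κ` is presented through `ι_B` by
`g(σ) = −⟨η σ, σ ỹ⟩~` whenever `1 ⊗ 1 ⊗ κ = ∂ỹ`). Here the VALUES of `g` are located, which is what the reduction modulo `Fil²`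
(`B₂ = B_dR⁺/Fil²`, Kato's `X`) of the line `kato_lever` needs:

* §1 ★ `IsCoboundaryLift.of_comp_injective` (generic, `GaloisRepresentations`): a presentation through `j ∘ ι` by `j ∘ f` along an
  injective equivariant additive `j : B → B'` DESCENDS to a presentation through `ι` by `f`.
* §2 `PeriodRingData.tensorRep_mem_filTensor` (generic): the diagonal action preserves `Filⁱ B ⊗ V`.
* §3 for a period-ring datum `𝔅` receiving `B_dR⁺` by `j` with `j(t) ∈ Fil¹` (`hjt`) and `hjq`: `periodLineB_mem_fil_one`
  (`ι_B(ζ) ∈ Fil¹`), ★ `weilPeriodPairing_mem_fil_one` (**`⟨S, y⟩~ ∈ Fil¹ B` for `y ∈ Fil⁰B ⊗ V_pW`**: `Fil⁰ · Fil¹ ⊆ Fil¹`), hence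
  ★ `weilCochain_mem_fil_one`: **`g(σ) = −⟨η σ, σ ỹ⟩~ ∈ Fil¹ B`** for `ỹ ∈ Fil⁰B ⊗ V_pW` (Kato: the cochain of Lemma 1.4.3 lies in
  `B_dR⁺(1) = Fil¹`).
* §4 the instance `B = B_dR(F)`: `bdRPlusToFrac_tBdR_mem_fil_one`, `exists_mem_span_xiBdR_of_mem_fil_one` (`Fil¹ B_dR = j(ξ B_dR⁺)`),
  and ★★ `exists_isCoboundaryLift_bdRPlus_of_isFilZeroCoboundary`: for cocycles `η, κ : Γ_F → T_pW` with `σ ↦ 1 ⊗ κ(σ)` a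
  `Fil⁰`-coboundary of `B_dR ⊗ V_pW` (brick K1 for Kummer cocycles), **there is a cochain `g⁺ : Γ_F → B_dR⁺(F)` with values in
  `Fil¹ = (ξ)`, mapping to `−⟨η σ, σ ỹ⟩~` in `B_dR`, which presents `η ∪_{e_∞} κ` through the period line `ι : ℤ_p(1) → B_dR⁺`
  ITSELF** (`IsCoboundaryLift (galRepr F p) (periodLine F p) g⁺ (e_∞.cupCocycle η κ)`) — so `[η ∪ κ] ∈ H²(F, ℤ_p(1))` is the
  connecting class `δ[g⁺ mod ℤ_p t]` of a `Fil¹B_dR⁺`-valued cochain, and (`tatePairing_eq_invPadic_of_bdRPlus_presentation`)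
  `⟨[η], [κ]⟩ = inv_∞[c]` for every continuous `c` presented by `g⁺`.

THEOREMS ONLY (no definition, no named fact, no instance, no `sorry`). Brick of the `B₂`-road memo (H1)+(H3)→(H4) of line `kato_lever`
(crux K★ `stmt-BirchSwinnertonDyer-22226`); BSD / K★ / [REC] are NOT proved by any of this.

## References
* K. Kato, LNM 1553 (1993), Ch. II §1.2.4–1.2.5, proof of Lemma 1.4.3 (the cochain in `X(1) ⊂ B_dR⁺(1)`). [Kato1993LNM1553]
* J.-M. Fontaine, Astérisque 223 (1994), Exp. II §1.5.5 (`Filⁱ B_dR = tⁱ B_dR⁺`), Exp. III §1.5. [FontaineAsterisque223III]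
* J. Neukirch, A. Schmidt, K. Wingberg (2008), I §3 (1.3.2). [NeukirchSchmidtWingberg2008]
-/

noncomputable section

open Field Function ValuativeRel WittVector
open scoped TensorProduct

universe u w

/-! ## §1 Descent of coboundary lifts along an injective equivariant map -/

namespace Literature.NumberTheory.GaloisRepresentations.IsCoboundaryLift

open _root_.TopRep _root_.ContRepresentation _root_.ContinuousCohomology

variable {R : Type*} [CommRing R] [TopologicalSpace R]
  {Γ : Type u} [Group Γ] [TopologicalSpace Γ]
  {M : Type u} [AddCommGroup M] [Module R M] [TopologicalSpace M] [IsTopologicalAddGroup M] [ContinuousSMul R M]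
  {ρ : ContinuousRep Γ R M}
  {S : Type*} [CommSemiring S] {B : Type*} [AddCommGroup B] [Module S B] {π : Representation S Γ B} {ι : M →+ B}
  {S' : Type*} [CommSemiring S'] {B' : Type*} [AddCommGroup B'] [Module S' B'] {π' : Representation S' Γ B'}

/-- ★ **Descent along an injective equivariant additive map.** If `j : B → B'` is additive, injective and intertwines `π`, `π'`, and
`j ∘ f` presents `c` through `j ∘ ι`, then `f` presents `c` through `ι` (converse of `IsCoboundaryLift.map`).
[cite: NeukirchSchmidtWingberg2008, I §3 (1.3.2)] -/
theorem of_comp_injective (j : B →+ B') (hjinj : Injective j) (hj : ∀ (σ : Γ) (b : B), j (π σ b) = π' σ (j b))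
    {f : Γ → B} {c : contTwoCocycles ρ.toTopRep} (h : IsCoboundaryLift π' (j.comp ι) (fun σ => j (f σ)) c) :
    IsCoboundaryLift π ι f c := fun σ τ =>
  hjinj (by rw [map_add, map_sub, hj]; exact h σ τ)

end Literature.NumberTheory.GaloisRepresentations.IsCoboundaryLift

/-! ## §2 The diagonal action preserves `Filⁱ B ⊗ V` -/

namespace Literature.NumberTheory.GaloisRepresentations.PeriodRingData

variable {Γ : Type u} [Group Γ] [TopologicalSpace Γ] {P : Type} {E : Type} [Field P] [TopologicalSpace P] [Field E] [Algebra P E]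
  {M : Type} [AddCommGroup M] [Module P M] [TopologicalSpace M]
  (𝔅 : PeriodRingData.{u, 0, 0, w} Γ P E) (ρ : ContinuousRep Γ P M)

/-- **`σ(Filⁱ B ⊗ V) ⊆ Filⁱ B ⊗ V`** for the diagonal action (`Filⁱ` is `Γ`-stable). [cite: FontaineAsterisque223III, Exp. III §1.5] -/
theorem tensorRep_mem_filTensor (σ : Γ) {i : ℤ} {y : 𝔅.B ⊗[P] M} (hy : y ∈ 𝔅.filTensor M i) :
    𝔅.tensorRep ρ σ y ∈ 𝔅.filTensor M i := by
  obtain ⟨z, rfl⟩ := hy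
  induction z using TensorProduct.induction_on with
  | zero => rw [map_zero, map_zero]; exact Submodule.zero_mem _
  | tmul b m =>
    rw [TensorProduct.AlgebraTensorModule.map_tmul, Submodule.subtype_apply, LinearMap.id_apply, tensorRep_apply_tmul]
    exact ⟨⟨σ • (b : 𝔅.B), 𝔅.smul_mem_fil σ i b b.2⟩ ⊗ₜ[P] ρ σ m, by
      rw [TensorProduct.AlgebraTensorModule.map_tmul, Submodule.subtype_apply, LinearMap.id_apply]⟩
  | add x y hx hy => rw [map_add, map_add]; exact Submodule.add_mem _ hx hy

end Literature.NumberTheory.GaloisRepresentations.PeriodRingData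

namespace Literature.NumberTheory.PAdicHodge

open Literature.NumberTheory.GaloisRepresentations
open Literature.NumberTheory.GaloisRepresentations.IsNonarchimedeanLocalField
open Literature.NumberTheory.GaloisCohomology
open Literature.NumberTheory.EllipticCurves
open _root_.WeierstrassCurve

variable {F : Type} [Field F] [ValuativeRel F] [TopologicalSpace F] [IsNonarchimedeanLocalField F] [CharZero F]
  {p : ℕ} [Fact p.Prime] [Fact (¬ IsUnit (p : integerC F))] [IsAdicComplete (Ideal.span {(p : integerC F)}) (integerC F)]
  [Algebra ℚ_[p] F] (𝔅 : PeriodRingData.{0, 0, 0, w} (absoluteGaloisGroup F) ℚ_[p] F) (j : BDeRhamPlus (integerC F) p →+* 𝔅.B)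
  {K₀ : Type} [Field K₀] (W : WeierstrassCurve K₀) [Algebra K₀ F]
  (e : (k : ℕ) → geomTorsion W ((p ^ k : ℕ) : ℤ) → geomTorsion W ((p ^ k : ℕ) : ℤ) → AlgebraicClosure K₀)
  (hμ : ∀ k S T, e k S T ^ (p ^ k) = 1) (hadd₁ : ∀ k S₁ S₂ T, e k (S₁ + S₂) T = e k S₁ T * e k S₂ T)
  (hadd₂ : ∀ k S T₁ T₂, e k S (T₁ + T₂) = e k S T₁ * e k S T₂)
  (hgal : ∀ k (σ : absoluteGaloisGroup K₀) (S T : geomTorsion W ((p ^ k : ℕ) : ℤ)), σ • e k S T = e k (σ • S) (σ • T))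
  (hcompat : ∀ k (S T : geomTorsion W ((p ^ (k + 1) : ℕ) : ℤ)),
    e k (torsionMulHom W (p ^ (k + 1)) (p ^ k) p (pow_succ p k).symm S)
      (torsionMulHom W (p ^ (k + 1)) (p ^ k) p (pow_succ p k).symm T) = e (k + 1) S T ^ p)
  (hjq : ∀ c : ℚ_[p], j (qpToBdR c) = algebraMap ℚ_[p] 𝔅.B c) (hjt : j tBdR ∈ 𝔅.fil 1)

/-! ## §3 `⟨S, y⟩~ ∈ Fil¹` for `y ∈ Fil⁰ B ⊗ V_pW` -/

section FilOne

omit [Algebra K₀ F] in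
include hjq hjt in
/-- `ι_B(ζ) = log_ε(ζ) · j(t) ∈ Fil¹ B`. [cite: FontaineAsterisque223III, Exp. II §1.5.5] -/
theorem periodLineB_mem_fil_one (ζ : (muPadicSystem F p).limit) : periodLineB 𝔅 j ζ ∈ 𝔅.fil 1 := by
  change j ((BdRPlusTop.of F p).symm (BdRPlusTop.periodLine F p ζ)) ∈ 𝔅.fil 1
  rw [BdRPlusTop.of_symm_periodLine, map_mul, hjq, PeriodRingData.algebraMap_eq, ← Algebra.smul_def]
  exact Submodule.smul_mem _ _ hjt

omit [ValuativeRel F] [TopologicalSpace F] [IsNonarchimedeanLocalField F] [CharZero F] [Fact (¬ IsUnit (p : integerC F))]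
  [IsAdicComplete (Ideal.span {(p : integerC F)}) (integerC F)] [Algebra ℚ_[p] F] [Algebra K₀ F] in
/-- An additive subgroup of the synonym `V_pW = ℚ_p ⊗_{ℤ_p} T_pW` containing all pure tensors is everything. [folklore] -/
private theorem addSubgroup_rational_eq_top {U : AddSubgroup (W.rationalTateModule p)}
    (h : ∀ (c : ℚ_[p]) (T : W.tateModule p), (c ⊗ₜ[ℤ_[p]] T : W.rationalTateModule p) ∈ U) : U = ⊤ :=
  eq_top_iff.2 fun v _ => TensorProduct.induction_on (motive := fun v => v ∈ U) v U.zero_mem h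
    (fun _ _ hx hy => U.add_mem hx hy)

include hjt in
/-- `⟨S, 1 ⊗ v⟩~ ∈ Fil¹ B` for every `v ∈ V_pW` (pure tensors: `c · ι_B(e_∞(S,T)) ∈ Fil¹`). [cite: Kato1993LNM1553, Ch. II, proof of Lemma 1.4.3] -/
theorem weilPeriodPairing_one_tmul_mem_fil_one (S : W.tateModule p) (v : W.rationalTateModule p) :
    weilPeriodPairing W 𝔅 j e hμ hadd₁ hadd₂ hcompat hjq S ((1 : 𝔅.B) ⊗ₜ[ℚ_[p]] v) ∈ 𝔅.fil 1 := by
  have htop := addSubgroup_rational_eq_top W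
    (U := (𝔅.fil 1).toAddSubgroup.comap ((weilPeriodPairing W 𝔅 j e hμ hadd₁ hadd₂ hcompat hjq S).comp
      (TensorProduct.mk ℚ_[p] 𝔅.B (W.rationalTateModule p) 1).toAddMonoidHom)) fun c T => by
      change weilPeriodPairing W 𝔅 j e hμ hadd₁ hadd₂ hcompat hjq S ((1 : 𝔅.B) ⊗ₜ[ℚ_[p]] (c ⊗ₜ[ℤ_[p]] T)) ∈ 𝔅.fil 1
      rw [weilPeriodPairing_tmul, one_mul, PeriodRingData.algebraMap_eq, ← Algebra.smul_def]
      exact Submodule.smul_mem _ _ (periodLineB_mem_fil_one 𝔅 j hjq hjt _)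
  have hv : v ∈ (⊤ : AddSubgroup (W.rationalTateModule p)) := AddSubgroup.mem_top v
  rw [← htop] at hv
  exact hv

include hjt in
/-- ★ **`⟨S, y⟩~ ∈ Fil¹ B` for `y ∈ Fil⁰B ⊗ V_pW`** (`⟨S, b ⊗ v⟩~ = b · ⟨S, 1 ⊗ v⟩~ ∈ Fil⁰ · Fil¹ ⊆ Fil¹`).
[cite: Kato1993LNM1553, Ch. II, proof of Lemma 1.4.3] [cite: FontaineAsterisque223III, Exp. III §1.5] -/
theorem weilPeriodPairing_mem_fil_one (S : W.tateModule p) {y : 𝔅.B ⊗[ℚ_[p]] W.rationalTateModule p}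
    (hy : y ∈ 𝔅.filTensor (W.rationalTateModule p) 0) :
    weilPeriodPairing W 𝔅 j e hμ hadd₁ hadd₂ hcompat hjq S y ∈ 𝔅.fil 1 := by
  obtain ⟨z, rfl⟩ := hy
  induction z using TensorProduct.induction_on with
  | zero => rw [map_zero, map_zero]; exact Submodule.zero_mem _
  | tmul b v =>
    rw [TensorProduct.AlgebraTensorModule.map_tmul, Submodule.subtype_apply, LinearMap.id_apply, weilPeriodPairing_tmul_eq_mul]
    have h := 𝔅.mul_mem_fil 0 1 (b : 𝔅.B) _ b.2 (weilPeriodPairing_one_tmul_mem_fil_one 𝔅 j W e hμ hadd₁ hadd₂ hcompat hjq hjt S v)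
    rwa [zero_add] at h
  | add x y hx hy => rw [map_add, map_add]; exact Submodule.add_mem _ hx hy

include hjt in
/-- ★ **The cochain of Kato's formal argument is `Fil¹`-valued**: for `ỹ ∈ Fil⁰B ⊗ V_pW` and every cocycle `η`,
`g(σ) = −⟨η σ, σ ỹ⟩~ ∈ Fil¹ B` (`σ ỹ ∈ Fil⁰B ⊗ V_pW`). [cite: Kato1993LNM1553, Ch. II, proof of Lemma 1.4.3] -/
theorem weilCochain_mem_fil_one [W.IsElliptic] (η : contOneCocycles (restrictedTateRep W F p).toTopRep)
    {y₀ : 𝔅.B ⊗[ℚ_[p]] W.rationalTateModule p} (hy₀ : y₀ ∈ 𝔅.filTensor (W.rationalTateModule p) 0)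
    (σ : absoluteGaloisGroup F) :
    -weilPeriodPairing W 𝔅 j e hμ hadd₁ hadd₂ hcompat hjq (η.1 σ) (𝔅.tensorRep (restrictedRationalTateRep W F p) σ y₀) ∈
      𝔅.fil 1 :=
  Submodule.neg_mem _ (weilPeriodPairing_mem_fil_one 𝔅 j W e hμ hadd₁ hadd₂ hcompat hjq hjt _
    (𝔅.tensorRep_mem_filTensor (restrictedRationalTateRep W F p) σ hy₀))

end FilOne

/-! ## §4 The instance `B = B_dR(F)`: lifting the cochain to `Fil¹ B_dR⁺(F)` -/

section BdR

variable (hp : valuation F p < 1)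

/-- Membership in `Fil¹` of the datum `bdRPeriodRingData hp`: `x = ξ · b` with `b ∈ B_dR⁺`. [cite: FontaineAsterisque223III, Exp. II §1.5.5] -/
theorem mem_fil_one_bdRPeriodRingData_iff {x : FracBdR F p} :
    x ∈ (bdRPeriodRingData (F := F) (p := p) hp).fil 1 ↔ ∃ b : BDeRhamPlus (integerC F) p,
      x = algebraMap (BDeRhamPlus (integerC F) p) (FracBdR F p) xiBdR * algebraMap (BDeRhamPlus (integerC F) p) (FracBdR F p) b := by
  haveI := isDomain_bDeRhamPlus (F := F) (p := p) (surjective_fontaineTheta_integerC hp)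
  have h : x ∈ (bdRPeriodRingData (F := F) (p := p) hp).fil 1 ↔ _ :=
    mem_fil_iff hp (surjective_fontaineTheta_integerC hp) (i := 1) (x := x)
  rw [h]
  simp only [zpow_one]

/-- **`j(ξ B_dR⁺) ⊆ Fil¹ B_dR`**: the image of `(ξ)` lies in `Fil¹`. [cite: FontaineAsterisque223III, Exp. II §1.5.5] -/
theorem bdRPlusToFrac_mem_fil_one_of_mem_span {b : BDeRhamPlus (integerC F) p}
    (hb : b ∈ Ideal.span {(xiBdR : BDeRhamPlus (integerC F) p)}) :
    bdRPlusToFrac hp b ∈ (bdRPeriodRingData (F := F) (p := p) hp).fil 1 := by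
  obtain ⟨c, rfl⟩ := Ideal.mem_span_singleton'.1 hb
  exact (mem_fil_one_bdRPeriodRingData_iff hp).2 ⟨c, by rw [mul_comm c, map_mul]; rfl⟩

/-- **`j(t) ∈ Fil¹ B_dR`** (`t ∈ (ξ)`): the hypothesis `hjt` for `B_dR`. [cite: FontaineAsterisque223III, Exp. II §1.5.4–1.5.5] -/
theorem bdRPlusToFrac_tBdR_mem_fil_one : bdRPlusToFrac hp tBdR ∈ (bdRPeriodRingData (F := F) (p := p) hp).fil 1 :=
  bdRPlusToFrac_mem_fil_one_of_mem_span hp tBdR_mem_span_xiBdR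

/-- **`Fil¹ B_dR = j(ξ B_dR⁺)`**: every element of `Fil¹` is the image of an element of `(ξ) = Fil¹ B_dR⁺`.
[cite: FontaineAsterisque223III, Exp. II §1.5.5] -/
theorem exists_mem_span_xiBdR_of_mem_fil_one {x : FracBdR F p} (hx : x ∈ (bdRPeriodRingData (F := F) (p := p) hp).fil 1) :
    ∃ b ∈ Ideal.span {(xiBdR : BDeRhamPlus (integerC F) p)}, bdRPlusToFrac hp b = x := by
  obtain ⟨c, rfl⟩ := (mem_fil_one_bdRPeriodRingData_iff hp).1 hx
  exact ⟨xiBdR * c, Ideal.mul_mem_right _ _ (Ideal.mem_span_singleton_self _), by rw [map_mul]; rfl⟩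

/-- `j : B_dR⁺ → B_dR` through `BdRPlusTop` intertwines `galRepr` and the action on `B_dR`. [cite: FontaineAsterisque223III, Exp. II §1.5.5] -/
theorem bdRPlusToFrac_of_symm_galRepr (σ : absoluteGaloisGroup F) (b : BdRPlusTop F p) :
    ((bdRPlusToFrac hp).toAddMonoidHom.comp (BdRPlusTop.of F p).symm.toAddMonoidHom) (BdRPlusTop.galRepr F p σ b) =
      σ • ((bdRPlusToFrac hp).toAddMonoidHom.comp (BdRPlusTop.of F p).symm.toAddMonoidHom) b :=
  bdRPlusToFrac_galBdRPlus hp σ ((BdRPlusTop.of F p).symm b)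

variable [W.IsElliptic] (halg : ∀ c : ℚ_[p], algebraMap ℚ_[p] F c = LocalField.padicRingHom F p hp c)

include hgal halg in
/-- ★★ **The Tate-pairing cocycle is presented through the period line `ι : ℤ_p(1) → B_dR⁺` by a `Fil¹ B_dR⁺`-valued cochain.** For
continuous cocycles `η, κ : Γ_F → T_pW` such that `σ ↦ 1 ⊗ κ(σ)` is a `Fil⁰`-coboundary of `B_dR(F) ⊗ V_pW` (brick K1 for Kummer
cocycles `κ_P`), there are `ỹ ∈ B_dR⁺ ⊗ V_pW` (`Fil⁰`) and a cochain `g⁺ : Γ_F → B_dR⁺(F)` with **`g⁺(σ) ∈ Fil¹ = (ξ)`**,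
**`g⁺(σ) = −⟨η σ, σ ỹ⟩~` in `B_dR`**, and **`ι((η ∪_{e_∞} κ)(σ, τ)) = σ g⁺(τ) − g⁺(στ) + g⁺(σ)`** in `B_dR⁺(F)`
(`IsCoboundaryLift (galRepr F p) (periodLine F p) g⁺`): the input of the reduction modulo `Fil²` (Kato's `X ⊂ B_dR⁺`, the `B₂`-road).
[cite: Kato1993LNM1553, Ch. II §1.2.4 and proof of Lemma 1.4.3] [cite: FontaineAsterisque223III, Exp. II §1.5.5] -/
theorem exists_isCoboundaryLift_bdRPlus_of_isFilZeroCoboundary (η κ : contOneCocycles (restrictedTateRep W F p).toTopRep)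
    (hκ : (bdRPeriodRingData (F := F) (p := p) hp).IsFilZeroCoboundary (restrictedRationalTateRep W F p)
      fun τ => (1 : (bdRPeriodRingData (F := F) (p := p) hp).B) ⊗ₜ[ℚ_[p]] TateModule.toRational p (κ.1 τ)) :
    ∃ y₀ ∈ (bdRPeriodRingData (F := F) (p := p) hp).filTensor (W.rationalTateModule p) 0,
      ∃ g : absoluteGaloisGroup F → BdRPlusTop F p,
        (∀ σ, g σ ∈ (BdRPlusTop.filOne F p).toIdeal) ∧
        (∀ σ, bdRPlusToFrac hp ((BdRPlusTop.of F p).symm (g σ)) =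
          -weilPeriodPairing W (bdRPeriodRingData hp) (bdRPlusToFrac hp) e hμ hadd₁ hadd₂ hcompat (bdRPlusToFrac_qpToBdR hp halg)
            (η.1 σ) ((bdRPeriodRingData hp).tensorRep (restrictedRationalTateRep W F p) σ y₀)) ∧
        IsCoboundaryLift (ρ := tateModuleMuPadic F p) (BdRPlusTop.galRepr F p) (BdRPlusTop.periodLine F p) g
          ((weilContPairingPadic W F p e hμ hadd₁ hadd₂ hgal hcompat).cupCocycle η κ) := by
  obtain ⟨y₀, hy₀, hlift⟩ := isCoboundaryLift_weilContPairingPadic_right_of_isFilZeroCoboundary W (bdRPeriodRingData hp)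
    (bdRPlusToFrac hp) e hμ hadd₁ hadd₂ hgal hcompat (bdRPlusToFrac_qpToBdR hp halg) (bdRPlusToFrac_galBdRPlus hp) η κ hκ
  -- the values `g(σ) ∈ Fil¹ B_dR` lift to `(ξ) ⊆ B_dR⁺`
  have hmem : ∀ σ, -weilPeriodPairing W (bdRPeriodRingData hp) (bdRPlusToFrac hp) e hμ hadd₁ hadd₂ hcompat
      (bdRPlusToFrac_qpToBdR hp halg) (η.1 σ) ((bdRPeriodRingData hp).tensorRep (restrictedRationalTateRep W F p) σ y₀) ∈
        (bdRPeriodRingData (F := F) (p := p) hp).fil 1 := fun σ =>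
    weilCochain_mem_fil_one (bdRPeriodRingData hp) (bdRPlusToFrac hp) W e hμ hadd₁ hadd₂ hcompat (bdRPlusToFrac_qpToBdR hp halg)
      (bdRPlusToFrac_tBdR_mem_fil_one hp) η hy₀ σ
  choose b hb hbg using fun σ => exists_mem_span_xiBdR_of_mem_fil_one hp (hmem σ)
  refine ⟨y₀, hy₀, fun σ => BdRPlusTop.of F p (b σ), fun σ => BdRPlusTop.mem_filOne_iff.2 (hb σ),
    fun σ => by rw [RingEquiv.symm_apply_apply]; exact hbg σ, ?_⟩
  refine IsCoboundaryLift.of_comp_injective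
    (π' := DistribMulAction.toModuleEnd F (bdRPeriodRingData (F := F) (p := p) hp).B)
    ((bdRPlusToFrac hp).toAddMonoidHom.comp (BdRPlusTop.of F p).symm.toAddMonoidHom)
    ((bdRPlusToFrac_injective hp).comp (BdRPlusTop.of F p).symm.injective) (bdRPlusToFrac_of_symm_galRepr hp) ?_
  refine hlift.congr fun σ => ?_
  change bdRPlusToFrac hp ((BdRPlusTop.of F p).symm (BdRPlusTop.of F p (b σ))) = _
  rw [RingEquiv.symm_apply_apply, hbg]

variable [LocallyCompactSpace (absoluteGaloisGroup F)] [CharZero K₀]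

omit [Algebra ℚ_[p] F] in
include hgal in
/-- ★★ **`⟨[η], [κ]⟩ = inv_∞[c]` for every continuous `2`-cocycle `c` of `ℤ_p(1)` presented THROUGH THE PERIOD LINE `ι : ℤ_p(1) → B_dR⁺`
by a `B_dR⁺`-valued cochain** `g⁺` as above (`ι` injective: `periodLine_injective`). [cite: Kato1993LNM1553, Ch. II §1.4, Thm. 1.4.1 (3) and proof of Lemma 1.4.3] -/
theorem tatePairing_eq_invPadic_of_bdRPlus_presentation (hF : Function.Surjective (fontaineTheta (integerC F) p))
    (η κ : contOneCocycles (restrictedTateRep W F p).toTopRep)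
    {g : absoluteGaloisGroup F → BdRPlusTop F p}
    (hg : IsCoboundaryLift (ρ := tateModuleMuPadic F p) (BdRPlusTop.galRepr F p) (BdRPlusTop.periodLine F p) g
      ((weilContPairingPadic W F p e hμ hadd₁ hadd₂ hgal hcompat).cupCocycle η κ))
    {c : contTwoCocycles (tateModuleMuPadic F p).toTopRep}
    (hc : IsCoboundaryLift (ρ := tateModuleMuPadic F p) (BdRPlusTop.galRepr F p) (BdRPlusTop.periodLine F p) g c) :
    tatePairing W F p e hμ hadd₁ hadd₂ hgal hcompat (oneCocycleClass _ η) (oneCocycleClass _ κ) =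
      invPadic F p (twoCocycleClass _ c) := by
  rw [tatePairing_oneCocycleClass_eq_invPadic_twoCocycleClass,
    hg.unique (BdRPlusTop.periodLine_injective hF) hc]

end BdR

end Literature.NumberTheory.PAdicHodge

end
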